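import Summits.BirchSwinnertonDyer.BirchSwinnertonDyer.Theorems.SignedLowerHalvesKobayashiLowerHalfLargeImageBSTWTwistConsumers
import Summits.BirchSwinnertonDyer.BirchSwinnertonDyer.Theorems.SignedLowerHalvesKobayashiLowerHalfSemistableScopeS
import Literature.NumberTheory.EllipticCurves.QuadraticTwistLocalDataAtTwoHoldsProofs
import Summits.BirchSwinnertonDyer.Rank1Residual.Additive.TwistRamTransport
import HarnessLib

/-!
# Route `SignedLowerHalves`, crux `KobayashiLowerHalfLargeImage` (item stmt-BirchSwinnertonDyer-19001): the BSTW-TWIST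
# SUB-FAMILY of class X7 — ROAD B1′'s AUXILIARY DATUM ON THE TWIST IS FREE, class-wide (cell `pub/bsd-litref`, paper
# sub-dir `bstw24`, prover seat `bsd-litref-bstw24-pv` gen 7; companion of `…BSTWTwistRecordShape.lean` p496534 /
# `…BSTWTwistConsumers.lean` p496619; a `--supports … --as helper` file; THEOREMS ONLY; closes nothing)

HONEST FRAMING (programme BSD-LIT2PART v1 §HONESTY, verbatim): «no tranche here proves BSD; ARM L moves the LITERAL
column of an r ≤ 1 census into the kernel-proved-modulo-named-print column; ARM P changes what "named print" is
worth.» Burungale–Skinner–Tian–Wan arXiv:2409.01350v2 is an UNREFEREED PREPRINT and NOTHING of it is used below: every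
theorem is an UNCONDITIONAL statement about quadratic twists, (ram) primes and auxiliary fields (modularity `hmod` and
Diamond/Ribet `hLL`, PUBLISHED, by name, enter the class-wide forms only). Records ≠ bookings; class X7 stays
CONSTRUCTION-SHAPED; crux 3 stays OPEN; the twist clause stays an OPEN binder; 0 cells move; typed ≠ proved ≠ endorsed.

WHY (referee C4 ROUND C4-R3-ADD-8, `pub/pub-bsdpct/REFEREE.md` l.8455, on the litref D-audit of the twist clause — sheets
`pub/bsd-litref/bstw24/sheets/D-AUDIT-bstw24-r1-TWIST-ADDENDUM-2.md` c4a37f440c810716, `…-r2-TWIST-ADDENDUM-4.md` 8b1a7d0e7d4c962d,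
`…-r2-TWIST-ADDENDUM-5.md` 81123e8e0e08ba94): ROAD B1′ («twist the CHARACTER, not the FORM») is ADMITTED for the 389
census pairs outside the scope `S_tw^aux ∪ S_tw^def`. BSTW's proof of Thm. 10.1 for `g_K = g ⊗ χ_K` (tex l.7456–7475:
«Since g is semistable, there exists a prime q ∣ N satisfying (ram) … Pick an imaginary quadratic field L such that (ord)
holds and (D_L, 2N) = 1 … q inert in L and the primes dividing N/q split … The same argument applies for the quadratic
twist g_K») then runs with `L` subject to the refereed hygiene (t2)/(L2) «every prime ℓ ∣ d_K splits in L» (= [CLW22,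
FMS 10 (2022) e110] Prop. 8.2.2 condition 2), ADOPTED BY THE DESK AS FREE HYGIENE OF RECORD, with R6 («… ∧ (D_L, d_K) =
1») the typer's option. THIS FILE MAKES «FREE» A KERNEL THEOREM. For the twist `E ≅ E₀^{(d)}` of a BODY datum (`E₀`
semistable, the ramified primes of `ℚ(√d)` good for `E₀`; `…BSTWTwistConsumers.lean`) the tree's predicate
`BSTWScope.HasAuxWitness W p` READ ON THE TWIST `W` is road B1′'s auxiliary datum: a (ram) prime `q` of `E` (= of `E₀`),
an imaginary quadratic `L` with `p` split, `q` inert, EVERY OTHER BAD PRIME OF `E` split — the bad primes of `E` are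
those of `E₀` AND those of `d_K` (§3), so (L2) is inside —, `(d_L, 2N_E) = 1` ⊇ `(D_L, d_K) = 1`, `2` split if good.

* §1–§2: Tate's algorithm is blind to a twist by a `v`-unit `4k + 1`, `k ∈ ℚ` `v`-integral (`kodairaSymbolAt_twistModel`,
  `ordMinimalDiscriminant_twistModel`; `ℚ`-parameter form of `Additive.kodairaSymbolAt_eq_of_twist_pStar`), so at a prime
  UNRAMIFIED in `ℚ(√d)` (`k = (d − 1)/4`) `E` is multiplicative iff `E₀` is, with the same `ord_ℓ Δ_min`;
* §3: at a prime RAMIFIED in `ℚ(√d)` where `E₀` is good, `E` is BAD (odd `ℓ`: additive,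
  `hasAdditiveReductionAt_quadraticTwist_of_dvd`; `ℓ = 2`: Barrios et al. 2025 Thm. 5.1, tree theorem
  `BarriosEtAl2025_quadraticTwist_two_of_goodReduction_holds`);
* §4: a (ram) prime of `E₀` is one of `E` (`ram_of_twistBody_of_ram`), hence `BSTWScope.HasAuxWitness W p` ON THE TWIST
  UNCONDITIONALLY from `Ram W₀ p` (`BSTWScope_hasAuxWitness_of_ram`: Dirichlet + CRT, class-number-free), and CLASS-WIDE
  for every BODY / INTRO twist datum at every odd `p` modulo modularity + Diamond/Ribet by name
  (`BSTWScope_exists_auxField_of_goodSS`): `ram_of_twistBody`, `hasAuxWitness_of_twistBody`, `hasAuxWitness_of_twistIntro`;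
* §5: (L2) and `(D_L, d_K) = 1` BY NAME for ANY auxiliary pair `(q, L)` of the twist.

So road B1′'s choice of `L` with the refereed hygiene EXISTS for every pair of the sub-family — per pair UNCONDITIONALLY
(`X7Twist.hasAuxWitness_of_certs`, p496534, or `hasAuxWitness_of_twistBody_of_ram`), class-wide modulo two PUBLISHED
facts. NOT supplied: the μ-step (T2a/T2b, tex l.7421–7428) and the `p = 3` tier — the desk's residual of record. No
tree binder consumes `HasAuxWitness` on a twist today (R6 untyped): helpers only. THEOREMS ONLY; axioms standard.

References: [BurungaleSkinnerTianWan2024] §10.3–10.4 (tex l.7456–7475), (ram) p. 14; [CastellaLiuWan2022] FMS Prop. 8.2.2;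
[SilvermanAEC2009] VII.1/VII.5/VIII.8; [SilvermanATAEC1994] IV.9.4; [BarriosEtAl2025] Thm. 5.1; [SkinnerUrban2014] Thm. 2;
[Ribet1990] Thm. 1.1; [Diamond1995RefinedSerre] Thm. 1.1.
-/

set_option autoImplicit false
set_option linter.dupNamespace false

noncomputable section

open scoped Classical
open IsDedekindDomain IsDedekindDomain.HeightOneSpectrum Rat.HeightOneSpectrum WeierstrassCurve NumberField
  Literature.NumberTheory.EllipticCurves Literature.NumberTheory.EllipticCurves.ModularForms
  Literature.NumberTheory.EllipticCurves.Rank1Residual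
  Literature.NumberTheory.EllipticCurves.BurungaleSkinnerTianWan2024
  Summit.BirchSwinnertonDyer.Rank1Residual.Supersingular

namespace Summit.BirchSwinnertonDyer.BirchSwinnertonDyer.Theorems.X7Twist

/-! ### §1 Tate's algorithm is blind to a twist by a `v`-unit `4k + 1`, `k ∈ ℚ` `v`-integral -/

section UnitTwist

variable (V : WeierstrassCurve ℚ) [V.IsElliptic] {W : WeierstrassCurve ℚ}

/-- The integral twist model `V.twistModel k` is an elliptic curve when `4k + 1` is a `v`-unit (hence `≠ 0`): it is
`ℚ`-isomorphic to `V^{(4k+1)}` (`exists_variableChange_twistModel_eq_quadraticTwist`). [folklore] -/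
theorem isElliptic_twistModel_of_valuation_eq_one (v : HeightOneSpectrum ℤ) {k : ℚ} (hd : v.valuation ℚ (4 * k + 1) = 1) :
    (V.twistModel k).IsElliptic := by
  have h0 : (4 * k + 1) ≠ 0 := by intro h; rw [h, map_zero] at hd; exact zero_ne_one hd
  haveI := V.isElliptic_quadraticTwist h0
  obtain ⟨C', -, hC'⟩ := exists_variableChange_twistModel_eq_quadraticTwist V k
  have : C'⁻¹ • V.quadraticTwist (4 * k + 1) = V.twistModel k := by rw [← hC', smul_smul, inv_mul_cancel, one_smul]
  rw [← this]; infer_instance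

/-- **Same Kodaira symbol** at a place `v` of `ℤ` for any equation `W ≅ V^{(4k+1)}` with `k ∈ ℚ` `v`-integral and
`4k + 1` a `v`-unit: the twisted equation is `ℚ`-isomorphic to `V.twistModel k`, whose Kodaira symbol at `v` is that of
`V` (`kodairaSymbolAt_twistModel`, `kodairaSymbolAt_smul'`); `ℚ`-parameter form of `Additive.kodairaSymbolAt_eq_of_twist_pStar`.
[cite: SilvermanATAEC1994, IV.9.4 (PDF pp. 344–346)] -/
theorem kodairaSymbolAt_eq_of_twist_unit (v : HeightOneSpectrum ℤ) {k : ℚ} (hk : v.valuation ℚ k ≤ 1)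
    (hd : v.valuation ℚ (4 * k + 1) = 1) (C : VariableChange ℚ) (hW : C • V.quadraticTwist (4 * k + 1) = W) :
    W.kodairaSymbolAt v = V.kodairaSymbolAt v := by
  haveI : PerfectField (IsLocalRing.ResidueField (v.adicCompletionIntegers ℚ)) := PerfectField.ofFinite
  haveI := isElliptic_twistModel_of_valuation_eq_one V v hd
  obtain ⟨C', -, hC'⟩ := exists_variableChange_twistModel_eq_quadraticTwist V k
  have hWm : W = (C * C') • V.twistModel k := by rw [mul_smul, hC', ← hW]
  rw [hWm, kodairaSymbolAt_smul', kodairaSymbolAt_twistModel v V hk hd]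

/-- **Same `ord_v Δ_min`** at a place `v` of `ℤ` for any equation `W ≅ V^{(4k+1)}` with `k ∈ ℚ` `v`-integral and
`4k + 1` a `v`-unit (`ordMinimalDiscriminant_twistModel`, `ordMinimalDiscriminant_smul_holds`); `ℚ`-parameter form of
`Additive.ordMinimalDiscriminant_eq_of_twist_pStar`. [cite: SilvermanAEC2009, VII.1 Prop. 1.3] -/
theorem ordMinimalDiscriminant_eq_of_twist_unit (v : HeightOneSpectrum ℤ) {k : ℚ} (hk : v.valuation ℚ k ≤ 1)
    (hd : v.valuation ℚ (4 * k + 1) = 1) (C : VariableChange ℚ) (hW : C • V.quadraticTwist (4 * k + 1) = W) :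
    W.ordMinimalDiscriminant v = V.ordMinimalDiscriminant v := by
  haveI := isElliptic_twistModel_of_valuation_eq_one V v hd
  obtain ⟨C', -, hC'⟩ := exists_variableChange_twistModel_eq_quadraticTwist V k
  have hWm : W = (C * C') • V.twistModel k := by rw [mul_smul, hC', ← hW]
  rw [hWm, ordMinimalDiscriminant_smul_holds v (V.twistModel k) (C * C'), ordMinimalDiscriminant_twistModel v V hk hd]

end UnitTwist

/-! ### §2 At a prime unramified in `ℚ(√d)`: multiplicative reduction and `ord Δ_min` transport -/

section Unramified

variable (V : WeierstrassCurve ℚ) [V.IsElliptic] [V.IsGloballyMinimal] (W : WeierstrassCurve ℚ) [W.IsElliptic]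
  [W.IsGloballyMinimal]

omit [V.IsElliptic] [V.IsGloballyMinimal] [W.IsElliptic] [W.IsGloballyMinimal] in
/-- At the place of `ℤ` over a prime `ℓ` UNRAMIFIED in `ℚ(√d)` (`¬ RamifiedInQuadratic d ℓ`: `ℓ ∤ d`, and
`d ≡ 1 (mod 4)` when `ℓ = 2`), the twist parameter `k = (d − 1)/4` is `v`-integral and `4k + 1 = d` is a `v`-unit.
[folklore] -/
theorem valuation_twistParam_of_not_ramifiedInQuadratic {d : ℤ} {ℓ : ℕ} (hℓ : ℓ.Prime)
    (hnr : ¬ RamifiedInQuadratic d ℓ) :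
    ((primesEquiv (R := ℤ)).symm ⟨ℓ, hℓ⟩).valuation ℚ (((d : ℚ) - 1) / 4) ≤ 1 ∧
      ((primesEquiv (R := ℤ)).symm ⟨ℓ, hℓ⟩).valuation ℚ (4 * (((d : ℚ) - 1) / 4) + 1) = 1 := by
  set v : HeightOneSpectrum ℤ := (primesEquiv (R := ℤ)).symm ⟨ℓ, hℓ⟩ with hvdef
  have hgen : natGenerator v = ℓ := congrArg Subtype.val ((primesEquiv (R := ℤ)).apply_symm_apply ⟨ℓ, hℓ⟩)
  have hℓd : ¬ (ℓ : ℤ) ∣ d := fun h ↦ hnr (Or.inl h)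
  have hdunit : v.valuation ℚ (d : ℚ) = 1 := by
    rw [Literature.NumberTheory.EllipticCurves.Rat.valuation_intCast_eq_one_iff, hgen]; exact hℓd
  refine ⟨?_, by rw [show (4 : ℚ) * (((d : ℚ) - 1) / 4) + 1 = (d : ℚ) by ring]; exact hdunit⟩
  by_cases hℓ2 : ℓ = 2
  · -- `d ≡ 1 (mod 4)`: `k` is an integer
    have hd4 : d % 4 = 1 := by by_contra h; exact hnr (Or.inr ⟨hℓ2, h⟩)
    obtain ⟨m, hm⟩ : ∃ m : ℤ, d = 4 * m + 1 := ⟨d / 4, by omega⟩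
    rw [show ((d : ℚ) - 1) / 4 = (m : ℚ) by rw [hm]; push_cast; ring,
      show (m : ℚ) = algebraMap ℤ ℚ m from (eq_intCast _ m).symm]
    exact v.valuation_le_one m
  · -- `ℓ` odd: `4` is a `v`-unit
    have h4 : v.valuation ℚ ((4 : ℤ) : ℚ) = 1 := by
      rw [Literature.NumberTheory.EllipticCurves.Rat.valuation_intCast_eq_one_iff, hgen]
      intro h
      have h2 : ℓ ∣ 2 := by
        have h' : ℓ ∣ 2 * 2 := by exact_mod_cast h
        rcases (Nat.Prime.dvd_mul hℓ).mp h' with h | h <;> exact h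
      exact hℓ2 ((Nat.prime_dvd_prime_iff_eq hℓ Nat.prime_two).mp h2)
    have hnum : v.valuation ℚ ((d : ℚ) - 1) ≤ 1 := by
      rw [show (d : ℚ) - 1 = ((d - 1 : ℤ) : ℚ) by push_cast; ring,
        show ((d - 1 : ℤ) : ℚ) = algebraMap ℤ ℚ (d - 1) from (eq_intCast _ _).symm]
      exact v.valuation_le_one _
    rw [map_div₀, show (4 : ℚ) = ((4 : ℤ) : ℚ) by norm_num, h4, div_one]
    exact hnum

omit [V.IsGloballyMinimal] [W.IsGloballyMinimal] in
/-- **Multiplicative reduction transports along a twist unramified at `ℓ`.** For `C • W = V^{(d)}` and a prime `ℓ`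
unramified in `ℚ(√d)`: `W` is multiplicative at `ℓ` iff `V` is — the Kodaira symbols at `ℓ` agree
(`kodairaSymbolAt_eq_of_twist_unit` with `k = (d − 1)/4`), and multiplicative reduction is "Kodaira symbol `Iₙ`, `n ≥ 1`"
(`kodairaSymbolAt_eq_I_iff_holds`, `ordMinimalDiscriminant_eq_zero_iff_holds`). [cite: SilvermanAEC2009, VII.5 Prop. 5.1(b)] -/
theorem mult_iff_of_twist_of_not_ramifiedInQuadratic {d : ℤ} {C : VariableChange ℚ}
    (hC : C • W = V.quadraticTwist (d : ℚ)) {ℓ : ℕ} [hℓ : Fact ℓ.Prime] (hnr : ¬ RamifiedInQuadratic d ℓ) :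
    Mult W ℓ ↔ Mult V ℓ := by
  set v : HeightOneSpectrum ℤ := (primesEquiv (R := ℤ)).symm ⟨ℓ, hℓ.out⟩ with hvdef
  obtain ⟨hk, hdv⟩ := valuation_twistParam_of_not_ramifiedInQuadratic (d := d) hℓ.out hnr
  have hW : C⁻¹ • V.quadraticTwist (4 * (((d : ℚ) - 1) / 4) + 1) = W := by
    rw [show (4 : ℚ) * (((d : ℚ) - 1) / 4) + 1 = (d : ℚ) by ring, ← hC, inv_smul_smul]
  have hK := kodairaSymbolAt_eq_of_twist_unit V v hk hdv C⁻¹ hW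
  have key : ∀ (X : WeierstrassCurve ℚ) [X.IsElliptic], Mult X ℓ ↔ ∃ n : ℕ, n ≠ 0 ∧ X.kodairaSymbolAt v = .I n := by
    intro X _
    rw [show Mult X ℓ ↔ X.HasMultiplicativeReductionAt v from
      X.hasMultiplicativeReductionAtPrime_iff_hasMultiplicativeReductionAt_holds ⟨ℓ, hℓ.out⟩]
    constructor
    · intro hm
      have hn : X.ordMinimalDiscriminant v ≠ 0 := fun h0 ↦
        hm.not_hasGoodReductionAt ((ordMinimalDiscriminant_eq_zero_iff_holds v X).mp h0)
      exact ⟨_, hn, (kodairaSymbolAt_eq_I_iff_holds v X hn).mpr ⟨hm, rfl⟩⟩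
    · rintro ⟨n, hn, hk⟩
      exact ((kodairaSymbolAt_eq_I_iff_holds v X hn).mp hk).1
  rw [key W, key V, hK]

/-- **`ord_ℓ Δ_min` transports along a twist unramified at `ℓ`**: for globally minimal `V`, `W` with
`C • W = V^{(d)}` and `ℓ` unramified in `ℚ(√d)`, `v_ℓ(Δ_min(W)) = v_ℓ(Δ_min(V))` (`ordMinimalDiscriminant_eq_of_twist_unit`
read through `factorization_minimalDiscriminantNorm_holds`). [cite: SilvermanAEC2009, VIII.8 (minimal discriminant) and VII.1 Prop. 1.3] -/
theorem padicValInt_minimalDiscriminantInt_eq_of_twist_of_not_ramifiedInQuadratic {d : ℤ} {C : VariableChange ℚ}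
    (hC : C • W = V.quadraticTwist (d : ℚ)) {ℓ : ℕ} [hℓ : Fact ℓ.Prime] (hnr : ¬ RamifiedInQuadratic d ℓ) :
    padicValInt ℓ W.minimalDiscriminantInt = padicValInt ℓ V.minimalDiscriminantInt := by
  set v : HeightOneSpectrum ℤ := (primesEquiv (R := ℤ)).symm ⟨ℓ, hℓ.out⟩ with hvdef
  have hgen : natGenerator v = ℓ := congrArg Subtype.val ((primesEquiv (R := ℤ)).apply_symm_apply ⟨ℓ, hℓ.out⟩)
  obtain ⟨hk, hdv⟩ := valuation_twistParam_of_not_ramifiedInQuadratic (d := d) hℓ.out hnr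
  have hW : C⁻¹ • V.quadraticTwist (4 * (((d : ℚ) - 1) / 4) + 1) = W := by
    rw [show (4 : ℚ) * (((d : ℚ) - 1) / 4) + 1 = (d : ℚ) by ring, ← hC, inv_smul_smul]
  have hO := ordMinimalDiscriminant_eq_of_twist_unit V v hk hdv C⁻¹ hW
  have bridge : ∀ (X : WeierstrassCurve ℚ) [X.IsElliptic] [X.IsGloballyMinimal],
      padicValInt ℓ X.minimalDiscriminantInt = X.ordMinimalDiscriminant v := by
    intro X _ _
    have h1 := X.factorization_minimalDiscriminantNorm_holds v
    rw [hgen, minimalDiscriminantNorm_int_eq_natAbs_minimalDiscriminantInt_holds X,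
      Nat.factorization_def _ hℓ.out] at h1
    rw [← h1]
    rfl
  rw [bridge W, bridge V, hO]

end Unramified

/-! ### §3 At a prime ramified in `ℚ(√d)` where `E₀` is good, the twist is bad -/

section Ramified

variable (V : WeierstrassCurve ℚ) [V.IsElliptic] [V.IsGloballyMinimal] (W : WeierstrassCurve ℚ) [W.IsElliptic]

omit [V.IsGloballyMinimal] in
/-- **A twist ramified at `2` of a curve good at `2` is bad at `2`** (any model): `d` square-free with `2` ramified in
`ℚ(√d)` means `d ≡ 2, 3 (mod 4)`, and then over `ℚ₂` the twist has Kodaira type `I₈*`/`II` resp. `I₄*`/`II*`, never `I₀`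
(Barrios et al. 2025 Thm. 5.1 = tree theorem `BarriosEtAl2025_quadraticTwist_two_of_goodReduction_holds`; the argument of
`GoldfeldGoodTwists.not_hasGoodReductionAtPrime_two_of_smul_eq_quadraticTwist`, route-free copy).
[cite: BarriosEtAl2025, Thm. 5.1 with the rows R = I₀ of the §5 tables (arXiv:2501.03209 pp. 15–16)] -/
theorem not_hasGoodReductionAtPrime_two_of_twist_of_ramifiedInQuadratic {d : ℤ} (hd : Squarefree d)
    {C : VariableChange ℚ} (hC : C • W = V.quadraticTwist (d : ℚ)) (hram : RamifiedInQuadratic d 2)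
    (hgood : V.HasGoodReductionAtPrime 2) : ¬ W.HasGoodReductionAtPrime 2 := by
  -- `4 ∤ d`, so `d ≡ 2` or `3 (mod 4)`
  have h4 : ¬ (4 : ℤ) ∣ d := by
    intro h
    rcases Int.isUnit_iff.mp (hd 2 (by norm_num; exact h)) with h1 | h1 <;> norm_num at h1
  have hd4 : d % 4 = 2 ∨ d % 4 = 3 := by
    rcases hram with h2 | ⟨-, h41⟩ <;> omega
  intro hgoodW
  haveI := TwistGoodTwo.perfectField_residueField_padicInt
  have hB := BarriosEtAl2025_quadraticTwist_two_of_goodReduction_holds (V.baseChange ℚ_[2]) hgood d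
  have hbc : (C.map (algebraMap ℚ ℚ_[2])) • W.baseChange ℚ_[2] = (V.baseChange ℚ_[2]).quadraticTwist (d : ℚ_[2]) := by
    simp only [WeierstrassCurve.baseChange]
    rw [map_variableChange, hC, map_quadraticTwist, map_intCast]
  have hI0 : (W.baseChange ℚ_[2]).kodairaSymbol ℤ_[2] = .I 0 := by
    haveI : ((W.baseChange ℚ_[2]).minimal ℤ_[2]).HasGoodReduction ℤ_[2] := hgoodW
    unfold WeierstrassCurve.kodairaSymbol
    exact TwistGoodTwo.kodairaSymbolOfMinimal_eq_I_zero_of_isUnit_Δ _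
      (TwistGoodTwo.isUnit_Δ_integralModel_of_hasGoodReduction _)
  have hK : ((V.baseChange ℚ_[2]).quadraticTwist (d : ℚ_[2])).kodairaSymbol ℤ_[2] = .I 0 := by
    rw [← hbc, kodairaSymbol_smul_holds ℤ_[2] (W.baseChange ℚ_[2]), hI0]
  rcases hd4 with h2 | h3
  · obtain ⟨h, -⟩ := hB.2.2 (by unfold Int.ModEq; omega)
    rw [hK] at h
    rcases h with h | h <;> exact absurd h (by decide)
  · obtain ⟨h, -⟩ := hB.2.1 (by unfold Int.ModEq; omega)
    rw [hK] at h
    rcases h with h | h <;> exact absurd h (by decide)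

/-- **The twist is BAD at every prime ramified in `ℚ(√d)` where `E₀` is good.** For `C • W = V^{(d)}`, `d`
square-free, `ℓ` ramified in `ℚ(√d)` (`ℓ ∣ d`, or `ℓ = 2 ∧ d ≢ 1 (mod 4)`) and `V` good at `ℓ`: `W` is not good at `ℓ`.
Odd `ℓ ∥ d`: the twist is ADDITIVE at `ℓ` (type `I₀*`; `hasAdditiveReductionAt_quadraticTwist_of_dvd`, transported along
`C` by `hasAdditiveReductionAt_smul_iff_holds`); `ℓ = 2`: the previous theorem. So the bad primes of the twist are EXACTLY
those of `E₀` and those of `d_K`. [cite: SilvermanAEC2009, VII.1 Remark 1.1 and VII.5 Prop. 5.1(c)]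
[cite: BarriosEtAl2025, Thm. 5.1 with the rows R = I₀ of the §5 tables (arXiv:2501.03209 pp. 15–16)] -/
theorem not_hasGoodReductionAtPrime_of_twist_of_ramifiedInQuadratic {d : ℤ} (hd : Squarefree d)
    {C : VariableChange ℚ} (hC : C • W = V.quadraticTwist (d : ℚ)) {ℓ : ℕ} [hℓ : Fact ℓ.Prime]
    (hram : RamifiedInQuadratic d ℓ) (hgood : V.HasGoodReductionAtPrime ℓ) : ¬ W.HasGoodReductionAtPrime ℓ := by
  have hℓP : ℓ.Prime := hℓ.out
  have hd0 : d ≠ 0 := hd.ne_zero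
  -- `ℓ² ∤ d`
  have hsq : ¬ (ℓ : ℤ) ^ 2 ∣ d := by
    intro h
    have h1 : (ℓ : ℤ) * (ℓ : ℤ) ∣ d := by rwa [← sq]
    have hu := hd _ h1
    rw [Int.isUnit_iff_natAbs_eq, Int.natAbs_natCast] at hu
    exact hℓP.ne_one hu
  by_cases hℓ2 : ℓ = 2
  · subst hℓ2
    exact not_hasGoodReductionAtPrime_two_of_twist_of_ramifiedInQuadratic V W hd hC hram hgood
  · have hℓd : (ℓ : ℤ) ∣ d := by
      rcases hram with h | ⟨h2, -⟩
      · exact h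
      · exact absurd h2 hℓ2
    obtain ⟨v, hv⟩ : ∃ v : HeightOneSpectrum (𝓞 ℚ), (primesEquiv v : ℕ) = ℓ :=
      ⟨primesEquiv.symm ⟨ℓ, hℓP⟩, by rw [Equiv.apply_symm_apply]⟩
    subst hv
    have hgoodv : V.HasGoodReductionAt v :=
      (hasGoodReductionAtPrime_iff_hasGoodReductionAt_ringOfIntegers v V).mp hgood
    have hadd : (V.quadraticTwist (d : ℚ)).HasAdditiveReductionAt v :=
      hasAdditiveReductionAt_quadraticTwist_of_dvd V v hℓ2 hd0 hℓd hsq hgoodv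
    have hdQ : ((d : ℤ) : ℚ) ≠ 0 := by exact_mod_cast hd0
    haveI := V.isElliptic_quadraticTwist hdQ
    have haddW : W.HasAdditiveReductionAt v := by
      rw [← hC] at hadd
      exact (hasAdditiveReductionAt_smul_iff_holds v W C).mp hadd
    intro hgoodW
    exact haddW.not_hasGoodReductionAt
      ((hasGoodReductionAtPrime_iff_hasGoodReductionAt_ringOfIntegers v W).mp hgoodW)

end Ramified

/-! ### §4 Road B1′'s auxiliary datum on the twist: (ram) transports, `HasAuxWitness` follows -/

section AuxWitness

variable (W : WeierstrassCurve ℚ) [W.IsElliptic] [W.IsGloballyMinimal] (p : ℕ) [Fact p.Prime]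

/-- **A (ram) prime of `E₀` is a (ram) prime of the twist.** For `C • W = W₀^{(d)}` with every prime ramified in `ℚ(√d)`
good for `W₀`: a (ram) prime `ℓ` of `W₀` is BAD for `W₀`, hence unramified in `ℚ(√d)`, hence (§2) transports. UNCONDITIONAL.
[cite: SkinnerUrban2014, Thm. 2 (p. 3), second bullet (shape of (ram) only)] [cite: SilvermanAEC2009, VII.5 Prop. 5.1(b), VII.1 Prop. 1.3] -/
theorem ram_of_twistBody_of_ram {W₀ : WeierstrassCurve ℚ} [W₀.IsElliptic] [W₀.IsGloballyMinimal] {d : ℤ}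
    (hgood : ∀ (q : ℕ) [Fact q.Prime], RamifiedInQuadratic d q → W₀.HasGoodReductionAtPrime q)
    {C : VariableChange ℚ} (hC : C • W = W₀.quadraticTwist (d : ℚ)) (hram : Ram W₀ p) : Ram W p := by
  obtain ⟨ℓ, hℓ, hℓp, hmult, hval⟩ := hram
  have hnr : ¬ RamifiedInQuadratic d ℓ := fun h ↦
    not_hasGoodReductionAtPrime_of_hasMultiplicativeReductionAtPrime ℓ hmult (hgood ℓ h)
  refine ⟨ℓ, hℓ, hℓp, (mult_iff_of_twist_of_not_ramifiedInQuadratic W₀ W hC hnr).mpr hmult, ?_⟩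
  rwa [padicValInt_minimalDiscriminantInt_eq_of_twist_of_not_ramifiedInQuadratic W₀ W hC hnr]

/-- **Road B1′'s auxiliary datum ON THE TWIST from a (ram) prime of `E₀`, UNCONDITIONAL**: `BSTWScope.HasAuxWitness W p`
— a (ram) prime `q` of `E`, an imaginary quadratic `L` with `p` split, `q` inert, every other bad prime of `E` split (so
every prime of `d_K`: the refereed hygiene (L2)), `(d_L, 2N_E) = 1` (so `(D_L, d_K) = 1`), `2` split if good — by the
tree's `BSTWScope_hasAuxWitness_of_ram` (Dirichlet + CRT; NO class-number condition). Closes nothing.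
[cite: SkinnerUrban2014, Thm. 2 (p. 3), second bullet (shape of (ram) only)] [cite: CastellaLiuWan2022, Prop. 8.2.2 (FMS 10 (2022) e110, p. 87; shape of condition 2 only)] -/
theorem hasAuxWitness_of_twistBody_of_ram {W₀ : WeierstrassCurve ℚ} [W₀.IsElliptic] [W₀.IsGloballyMinimal] {d : ℤ}
    (hgood : ∀ (q : ℕ) [Fact q.Prime], RamifiedInQuadratic d q → W₀.HasGoodReductionAtPrime q)
    {C : VariableChange ℚ} (hC : C • W = W₀.quadraticTwist (d : ℚ)) (hram : Ram W₀ p) :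
    BSTWScope.HasAuxWitness W p :=
  BSTWScope_hasAuxWitness_of_ram W p (ram_of_twistBody_of_ram W p hgood hC hram)

/-- **(ram) for the twist, CLASS-WIDE for every BODY twist datum at every odd `p`**, modulo modularity `hmod` and `hLL` =
Diamond 1995 / Ribet 1990 (PUBLISHED, by name): `W₀` is semistable with `W₀[p]` irreducible (supersingular, `p` odd), so
it has a (ram) prime by level-lowering (`BSTWScope_exists_auxField_of_goodSS`), which transports to the twist. This is tex
l.7456 «Since g is semistable, there exists a prime q ∣ N satisfying (ram) …» READ FOR `g_K`. Closes nothing.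
[cite: Ribet1990, Thm. 1.1] [cite: Diamond1995RefinedSerre, Thm. 1.1] -/
theorem ram_of_twistBody (hmod : exists_isNewformOf)
    (hLL : Literature.NumberTheory.Automorphic.diamond1995_refinedSerre) (hp2 : p ≠ 2)
    (htw : ∃ (W₀ : WeierstrassCurve ℚ) (_ : W₀.IsElliptic) (_ : W₀.IsGloballyMinimal) (d : ℤ) (C : VariableChange ℚ),
      Semistable W₀ ∧ GoodSS W₀ p ∧ W₀.frobeniusTrace p = 0 ∧ Squarefree d ∧ d ≠ 1 ∧
      (∀ (q : ℕ) [Fact q.Prime], RamifiedInQuadratic d q → q ≠ p ∧ W₀.HasGoodReductionAtPrime q) ∧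
      C • W = W₀.quadraticTwist (d : ℚ)) : Ram W p := by
  obtain ⟨W₀, _, _, d, C, hsst, hss, -, -, -, hgood, hC⟩ := htw
  obtain ⟨q, hq, -, -, -, haux, -⟩ := BSTWScope_exists_auxField_of_goodSS hmod hLL W₀ p hp2 hsst hss
  exact ram_of_twistBody_of_ram W p (fun ℓ _ h ↦ (hgood ℓ h).2) hC ⟨q, hq, haux.1, haux.2.1, haux.2.2⟩

/-- **ROAD B1′'s AUXILIARY DATUM IS FREE, CLASS-WIDE: `BSTWScope.HasAuxWitness W p` for EVERY BODY twist datum at every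
odd `p`**, modulo modularity + Diamond/Ribet by name. For each of the 415 BODY census pairs `htw` is the pair's
UNCONDITIONAL record `twist_x7bstw_<label>_<p>`, so the auxiliary field of BSTW's proof of Thm. 10.1 for `g_K` WITH the
refereed hygiene «every ℓ ∣ d_K split in L, (D_L, d_K) = 1» (referee C4 ROUND C4-R3-ADD-8: (L2) free hygiene; R6) EXISTS
for every pair. NOT supplied: the μ-step (T2a/T2b) and the `p = 3` tier. Closes nothing; 0 cells move.
[cite: Ribet1990, Thm. 1.1] [cite: Diamond1995RefinedSerre, Thm. 1.1] [cite: CastellaLiuWan2022, Prop. 8.2.2 (FMS 10 (2022) e110, p. 87; shape of condition 2 only)] -/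
theorem hasAuxWitness_of_twistBody (hmod : exists_isNewformOf)
    (hLL : Literature.NumberTheory.Automorphic.diamond1995_refinedSerre) (hp2 : p ≠ 2)
    (htw : ∃ (W₀ : WeierstrassCurve ℚ) (_ : W₀.IsElliptic) (_ : W₀.IsGloballyMinimal) (d : ℤ) (C : VariableChange ℚ),
      Semistable W₀ ∧ GoodSS W₀ p ∧ W₀.frobeniusTrace p = 0 ∧ Squarefree d ∧ d ≠ 1 ∧
      (∀ (q : ℕ) [Fact q.Prime], RamifiedInQuadratic d q → q ≠ p ∧ W₀.HasGoodReductionAtPrime q) ∧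
      C • W = W₀.quadraticTwist (d : ℚ)) : BSTWScope.HasAuxWitness W p :=
  BSTWScope_hasAuxWitness_of_ram W p (ram_of_twistBody W p hmod hLL hp2 htw)

/-- **The same from an INTRO twist datum** (good ordinary ⟹ good, `twistBody_of_twistIntro`). Closes nothing.
[cite: Ribet1990, Thm. 1.1] [cite: Diamond1995RefinedSerre, Thm. 1.1] -/
theorem hasAuxWitness_of_twistIntro (hmod : exists_isNewformOf)
    (hLL : Literature.NumberTheory.Automorphic.diamond1995_refinedSerre) (hp2 : p ≠ 2)
    (htw : ∃ (W₀ : WeierstrassCurve ℚ) (_ : W₀.IsElliptic) (_ : W₀.IsGloballyMinimal) (d : ℤ) (C : VariableChange ℚ),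
      Semistable W₀ ∧ GoodSS W₀ p ∧ W₀.frobeniusTrace p = 0 ∧ Squarefree d ∧ d ≠ 1 ∧
      (∀ (q : ℕ) [Fact q.Prime], RamifiedInQuadratic d q → q ≠ p ∧ GoodOrd W₀ q) ∧
      C • W = W₀.quadraticTwist (d : ℚ)) : BSTWScope.HasAuxWitness W p :=
  hasAuxWitness_of_twistBody W p hmod hLL hp2 (twistBody_of_twistIntro W p htw)

/-! ### §5 The (L2) and `(D_L, d_K) = 1` clauses BY NAME -/

omit [W.IsGloballyMinimal] [Fact p.Prime] in
/-- **Every auxiliary field of the twist splits the primes of `d_K` and has discriminant prime to `d_K`** — (L2) (=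
[CLW22] Prop. 8.2.2 condition 2) and R6's `(D_L, d_K) = 1`, BY NAME: for `C • W = W₀^{(d)}` (`d` square-free, ramified
primes good for `W₀`), `q` bad for `W₀` and ANY `L` with `BSTWScope.IsAuxiliaryField W p q L`, each prime `ℓ` of `d_K` is
bad for `W` (§3) and `≠ q`, so it SPLITS in `L` and `ℓ ∤ d_L`. UNCONDITIONAL; closes nothing.
[cite: CastellaLiuWan2022, Prop. 8.2.2 (FMS 10 (2022) e110, p. 87; shape of condition 2 only)] -/
theorem splits_and_not_dvd_discr_of_isAuxiliaryField_of_twist {W₀ : WeierstrassCurve ℚ} [W₀.IsElliptic]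
    [W₀.IsGloballyMinimal] {d : ℤ} (hd : Squarefree d)
    (hgood : ∀ (q : ℕ) [Fact q.Prime], RamifiedInQuadratic d q → W₀.HasGoodReductionAtPrime q)
    {C : VariableChange ℚ} (hC : C • W = W₀.quadraticTwist (d : ℚ)) {q : ℕ} [Fact q.Prime]
    (hq : ¬ W₀.HasGoodReductionAtPrime q) {L : Type} [Field L] [NumberField L]
    (hL : BSTWScope.IsAuxiliaryField W p q L) {ℓ : ℕ} (hℓ : ℓ.Prime) (hram : RamifiedInQuadratic d ℓ) :
    ((Ideal.span {(ℓ : ℤ)}).primesOver (𝓞 L)).ncard = 2 ∧ ¬ (ℓ : ℤ) ∣ NumberField.discr L := by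
  haveI : Fact ℓ.Prime := ⟨hℓ⟩
  have hbad : ¬ W.HasGoodReductionAtPrime ℓ :=
    not_hasGoodReductionAtPrime_of_twist_of_ramifiedInQuadratic W₀ W hd hC hram (hgood ℓ hram)
  have hℓq : ℓ ≠ q := by
    rintro rfl; exact hq (hgood ℓ hram)
  obtain ⟨-, -, -, hsplit, -, hdisc, -⟩ := hL
  exact ⟨hsplit ℓ hℓ hℓq hbad, hdisc ℓ hℓ hbad⟩

omit [W.IsGloballyMinimal] [Fact p.Prime] in
/-- **Packaged with `W₀`, `d` displayed: any auxiliary pair `(q, L)` of the twist with `q` a (ram) prime of `W₀` satisfies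
(L2) and `(D_L, d_K) = 1`** (for per-pair records, which cite their literal `d`). Closes nothing.
[cite: CastellaLiuWan2022, Prop. 8.2.2 (FMS 10 (2022) e110, p. 87; shape of condition 2 only)] -/
theorem splits_and_not_dvd_discr_of_isAuxiliaryPrime_of_isAuxiliaryField_of_twist {W₀ : WeierstrassCurve ℚ}
    [W₀.IsElliptic] [W₀.IsGloballyMinimal] {d : ℤ} (hd : Squarefree d)
    (hgood : ∀ (q : ℕ) [Fact q.Prime], RamifiedInQuadratic d q → W₀.HasGoodReductionAtPrime q)
    {C : VariableChange ℚ} (hC : C • W = W₀.quadraticTwist (d : ℚ)) {q : ℕ} [Fact q.Prime]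
    (hq : BSTWScope.IsAuxiliaryPrime W₀ p q) {L : Type} [Field L] [NumberField L]
    (hL : BSTWScope.IsAuxiliaryField W p q L) :
    ∀ ℓ : ℕ, ℓ.Prime → RamifiedInQuadratic d ℓ →
      ((Ideal.span {(ℓ : ℤ)}).primesOver (𝓞 L)).ncard = 2 ∧ ¬ (ℓ : ℤ) ∣ NumberField.discr L :=
  fun _ hℓ hram ↦ splits_and_not_dvd_discr_of_isAuxiliaryField_of_twist W p hd hgood hC
    (not_hasGoodReductionAtPrime_of_hasMultiplicativeReductionAtPrime q hq.2.1) hL hℓ hram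

end AuxWitness

end Summit.BirchSwinnertonDyer.BirchSwinnertonDyer.Theorems.X7Twist
end
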